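import Mathlib
import Summits.Parity.BatemanHorn.Theses.IsogenyRedei
import Summits.Parity.BatemanHorn.Theorems.IsogenyRedeiSplitBlockJacobiBulkReduction
import Summits.Parity.BatemanHorn.Theorems.IsogenyRedeiSplitBlockJacobiPairForm
import Summits.Parity.BatemanHorn.Theorems.IsogenyRedeiSplitBlockJacobiExpectedPart
import Summits.Parity.BatemanHorn.Theorems.IsogenyRedeiSplitBlockJacobiSmallCofactorTail
import HarnessLib

/-!
# `SplitBlockJacobi` from the `h`-summed bulk root discrepancy — unconditional reduction

Crux `IsogenyRedei.SplitBlockJacobi` (stmt-Parity-11583), line `cofactor-root-discrepancy` (second lead).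
With the three TRUE stubs of the line now in the tree — the pair-side Fubini identity `stub_pairForm`
(`…PairForm`), the cancellation of the expected part `stub_expectedPart` (multiplicative large sieve,
`…ExpectedPart`) and the peelability of the small-cofactor tail `stub_smallCofactorTail` (window β-sieve on
`t²+1`, `…SmallCofactorTail`) — the composition `splitBlockJacobi_of_bulkDiscrepancy` (`…BulkReduction`)
becomes the unconditional implication: the line's residual "R2"
(`BulkDiscrepancyCancels`: for every tier `μ ∈ (0,1)` the `(Q|Q′)`-weighted discrepancy of the small roots
of `−1` over the bulk `QQ′ ≤ x^{2−μ}` is `o(x)`) implies the crux.  Stated def-free.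
-/

noncomputable section

namespace Summit.Parity.BatemanHorn.Cruxes.SplitBlockJacobi.CofactorRootDiscrepancy

/-- **R2 ⇒ crux, unconditionally.**  If for every `θ ∈ (1/2,1)`, every tier `μ ∈ (0,1)` and every
`ε > 0`, eventually `|Σ_{(Q,Q′) ∈ pairs θ x, QQ′ ≤ x^{2−μ}} (Q|Q′)·(#{t ≤ x : QQ′ ∣ t²+1} − 4x/(QQ′))| ≤ εx`,
then `SplitBlockJacobi` holds.  (The three other inputs of `splitBlockJacobi_of_bulkDiscrepancy` are the
landed theorems `stub_pairForm`, `stub_expectedPart`, `stub_smallCofactorTail`.) -/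
theorem splitBlockJacobi_of_bulkDiscrepancyCancels :
    (∀ θ μ : ℝ, 1 / 2 < θ → θ < 1 → 0 < μ → μ < 1 → ∀ ε : ℝ, 0 < ε →
      ∀ᶠ x : ℕ in Filter.atTop,
        |∑ q ∈ ((Finset.range (x ^ 2 + 2) ×ˢ Finset.range (x ^ 2 + 2)).filter (fun q : ℕ × ℕ =>
            q.1.Prime ∧ q.2.Prime ∧ q.1 % 4 = 1 ∧ q.2 % 4 = 1 ∧ (x : ℝ) ^ θ < (q.1 : ℝ) ∧ q.1 < q.2 ∧
              q.1 * q.2 ≤ x ^ 2 + 1)).filter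
            (fun q : ℕ × ℕ => ((q.1 * q.2 : ℕ) : ℝ) ≤ (x : ℝ) ^ (2 - μ)),
          (jacobiSym (q.1 : ℤ) q.2 : ℝ) *
            (((((Finset.Icc 1 x).filter (fun t : ℕ => q.1 * q.2 ∣ t ^ 2 + 1)).card : ℕ) : ℝ) -
              4 * (x : ℝ) / ((q.1 * q.2 : ℕ) : ℝ))| ≤ ε * x) →
    Summit.Parity.BatemanHorn.Theses.IsogenyRedei.SplitBlockJacobi :=
  fun hB => splitBlockJacobi_of_bulkDiscrepancy stub_pairForm stub_expectedPart stub_smallCofactorTail hB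

end Summit.Parity.BatemanHorn.Cruxes.SplitBlockJacobi.CofactorRootDiscrepancy

end
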